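import Literature.NumberTheory.Transcendental.RoySmallValueStep2Tests
import HarnessLib

/-!
# Roy's small value estimate for `𝔾ₐ × 𝔾ₘ` — §7 Step 2, point by point: tests bounding `max{T log dist(α,(1:γ)), log dist(α,A_γ)}`

Topic `Literature/NumberTheory/Transcendental`. Part of the formalisation of the proof of Roy 2013,
Theorem 1.1 (named fact `roy2013_thm_1_1`, `RoySmallValueEstimates.lean`), seat B. Source: D. Roy,
*A small value estimate for `𝔾ₐ × 𝔾ₘ`*, Mathematika 59 (2013) 333–363 = arXiv:1301.0663, §7,
Step 2 (p. 18 of the arXiv text):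

> For each `α ∈ Z(ℂ) ∖ 𝒰`, Proposition 4.2 gives
> `|I_D^{(γ,T)}|_α ≥ c₅^{−T} T^{−6T log(T)} dist(α,(1:γ))^T ≥ (2c₂c₅)^{−T} T^{−6T log(T)}` [...]
> For the more interesting points `α ∈ 𝒰`, it gives
> `|I_D^{(γ,T)}|_α ≥ c₄⁻¹c₅^{−T}T^{−6T log(T)} max{dist(α,(1:γ))^T, dist(α,A_γ)}` [...]

Point by point, in test-family language (tests `R ∈ 𝒞 = royBody D ξ η Y U T` from
`RoySmallValueStep2Tests`): for a sup-normalised `u` (all `|uᵢ| ≤ 1`, some `|uᵢ| = 1`) with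
`dist(u,(1:γ)) > 0`,

* `exists_test_near` — if `u ∈ 𝒰` (`dist(u,(1:γ)) ≤ (2c₂)⁻¹`): some `R ∈ 𝒞` has `R(u) ≠ 0` and
  `Y + max{T log d₁(u), log⁎ d₂(u)} ≤ Γ + log|R(u)|`, where `log⁎ d₂ = log d₂` if `d₂ > 0` and
  `T log d₁` if `d₂ = 0` (the honest value of `max{T log d₁, log d₂}` with `log 0 = −∞`), and
  `Γ = max{log(2^TΛ^k), log(2C)} + |log(2C')|` collects the constants of `prop_4_5_i/ii`;
* `exists_test_far` — if `u ∉ 𝒰`: some `R ∈ 𝒞` has `R(u) ≠ 0` and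
  `Y + T log((2c₂)⁻¹) ≤ log(2^TΛ^k) + log|R(u)|`.

Everything is proved; no definitions, no named facts.

## References

* [Roy2013] D. Roy, *A small value estimate for 𝔾ₐ × 𝔾ₘ*, Mathematika 59 (2013), 333–363
  (arXiv:1301.0663), §7, Step 2 and Proposition 4.2.
-/

noncomputable section

open MvPolynomial Finset

namespace Literature.NumberTheory.Transcendental

namespace Roy2013

/-- From `e^Y x ≤ A y` with `x > 0`, `A > 0`: `y > 0` and `Y + log x ≤ log A + log y`. [folklore] -/
theorem log_le_of_exp_mul_le {Y x A y : ℝ} (hx : 0 < x) (hA : 0 < A) (hy0 : 0 ≤ y)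
    (h : Real.exp Y * x ≤ A * y) : 0 < y ∧ Y + Real.log x ≤ Real.log A + Real.log y := by
  have hL : 0 < Real.exp Y * x := mul_pos (Real.exp_pos Y) hx
  have hy : 0 < y := by
    rcases hy0.lt_or_eq with hlt | heq
    · exact hlt
    · rw [← heq, mul_zero] at h; linarith
  refine ⟨hy, ?_⟩
  have := Real.log_le_log hL h
  rwa [Real.log_mul (Real.exp_pos Y).ne' hx.ne', Real.log_exp, Real.log_mul hA.ne' hy.ne'] at this

/-- **Points of `𝒰`**: see the module docstring. [cite: Roy2013, §7, Step 2 (points of `𝒰`), Proposition 4.2] -/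
theorem exists_test_near {ξ η : ℂ} (hη : η ≠ 0) {L T D k : ℕ} (hT₁ : (L + 1).choose 2 < T)
    (hT₂ : T ≤ (L + 2).choose 2) (hD : 3 * (L + 1) ≤ D) (hDT : D ≤ T)
    (hk : 2 ^ k * T ≤ 3 ^ k * D) {u : Fin 3 → ℂ} (hu : ∀ i, ‖u i‖ ≤ 1) (hu1 : ∃ i, 1 ≤ ‖u i‖)
    (hd₁ : 0 < pdist ξ η u) (hdU : pdist ξ η u ≤ (2 * roy_c2 ξ η)⁻¹) (Y U : ℝ) :
    ∃ R ∈ royBody D ξ η Y U T, 0 < ‖eval u R‖ ∧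
      Y + max (T * Real.log (pdist ξ η u))
          (if 0 < adist ξ η u then Real.log (adist ξ η u) else T * Real.log (pdist ξ η u)) ≤
        (max (Real.log (2 ^ T * (3 * (3 * (1 + ‖ξ‖ + ‖η‖⁻¹) * max 1 (max ‖ξ‖ ‖η‖)) ^ T *
              (16 * (T : ℝ) ^ 3) ^ T) ^ k))
            (Real.log (2 * ((2 * roy_c2 ξ η) ^ T * (1 + roy_c2 ξ η * Real.exp (1 + roy_c2 ξ η)) *
              (3 * (3 * (1 + ‖ξ‖ + ‖η‖⁻¹) * max 1 (max ‖ξ‖ ‖η‖)) ^ T *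
                (16 * (T : ℝ) ^ 3) ^ T) ^ k))) +
          |Real.log (2 * (roy_c2 ξ η * Real.exp (roy_c2 ξ η) * (2 * roy_c2 ξ η ^ 2) ^ T))|) +
        Real.log ‖eval u R‖ := by
  -- constants
  obtain ⟨Λ, hΛ⟩ : ∃ Λ : ℝ, Λ = (3 * (3 * (1 + ‖ξ‖ + ‖η‖⁻¹) * max 1 (max ‖ξ‖ ‖η‖)) ^ T *
      (16 * (T : ℝ) ^ 3) ^ T) := ⟨_, rfl⟩
  obtain ⟨A, hA⟩ : ∃ A : ℝ, A = 2 ^ T * Λ ^ k := ⟨_, rfl⟩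
  obtain ⟨Cc, hCc⟩ : ∃ Cc : ℝ, Cc = (2 * roy_c2 ξ η) ^ T * (1 + roy_c2 ξ η * Real.exp (1 + roy_c2 ξ η)) *
      Λ ^ k := ⟨_, rfl⟩
  obtain ⟨C', hC'⟩ : ∃ C' : ℝ, C' = roy_c2 ξ η * Real.exp (roy_c2 ξ η) * (2 * roy_c2 ξ η ^ 2) ^ T :=
    ⟨_, rfl⟩
  have hc2 : 1 ≤ roy_c2 ξ η := one_le_roy_c2 ξ η
  have hTpos : (0 : ℝ) < T := by exact_mod_cast lt_of_le_of_lt (Nat.zero_le _) hT₁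
  have hbase : (0 : ℝ) < 3 * (1 + ‖ξ‖ + ‖η‖⁻¹) * max 1 (max ‖ξ‖ ‖η‖) := by positivity
  have h16 : (0 : ℝ) < 16 * (T : ℝ) ^ 3 := mul_pos (by norm_num) (pow_pos hTpos 3)
  have hΛ0 : 0 < Λ := by
    rw [hΛ]; exact mul_pos (mul_pos three_pos (pow_pos hbase _)) (pow_pos h16 _)
  have hA0 : 0 < A := by rw [hA]; positivity
  have hCc0 : 0 < Cc := by rw [hCc]; positivity
  have hC'0 : 0 < C' := by rw [hC']; positivity
  simp only [← hΛ]
  rw [← hA, ← hCc, ← hC']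
  obtain ⟨d₁, hd₁def⟩ : ∃ d₁ : ℝ, d₁ = pdist ξ η u := ⟨_, rfl⟩
  obtain ⟨d₂, hd₂def⟩ : ∃ d₂ : ℝ, d₂ = adist ξ η u := ⟨_, rfl⟩
  rw [← hd₁def] at hd₁ hdU ⊢
  rw [← hd₂def]
  have hd₂0 : 0 ≤ d₂ := by rw [hd₂def]; exact adist_nonneg ξ η u
  -- the chart condition
  have hu0 : (2 * roy_c2 ξ η)⁻¹ ≤ ‖u 0‖ := lemma_4_1 hu1 (by rw [← hd₁def]; exact hdU)
  by_cases hcase : 2 * C' * d₁ ^ T ≤ d₂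
  · -- Case B: the `A_γ`-test
    have hd₂ : 0 < d₂ := lt_of_lt_of_le (by positivity) hcase
    obtain ⟨R, hR, hineq0⟩ := exists_test_adist hη hT₁ hT₂ hD hDT hk hu hu0 (by rw [← hd₁def]; exact hdU) Y U
    have hineq : Real.exp Y * d₂ ≤ Cc * ‖eval u R‖ + Real.exp Y * (C' * d₁ ^ T) := by
      rw [hCc, hC', hΛ, hd₁def, hd₂def]; exact hineq0
    -- `e^Y d₂ / 2 ≤ Cc |R(u)|`
    have h1 : Real.exp Y * (d₂ / 2) ≤ Cc * ‖eval u R‖ := by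
      have h2 : Real.exp Y * (C' * d₁ ^ T) ≤ Real.exp Y * (d₂ / 2) :=
        mul_le_mul_of_nonneg_left (by linarith) (Real.exp_pos Y).le
      linarith
    obtain ⟨hRpos, hlog⟩ := log_le_of_exp_mul_le (by linarith) hCc0 (norm_nonneg _) h1
    refine ⟨R, hR, hRpos, ?_⟩
    rw [if_pos hd₂]
    -- `max{T log d₁, log d₂} ≤ log d₂ + |log(2C')|`
    have hTd₁ : T * Real.log d₁ ≤ Real.log d₂ - Real.log (2 * C') := by
      have h3 : Real.log (2 * C' * d₁ ^ T) ≤ Real.log d₂ := Real.log_le_log (by positivity) hcase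
      rw [Real.log_mul (by positivity) (by positivity), Real.log_pow] at h3
      linarith
    have hmax : max (T * Real.log d₁) (Real.log d₂) ≤ Real.log d₂ + |Real.log (2 * C')| := by
      refine max_le ?_ ?_
      · linarith [neg_abs_le (Real.log (2 * C'))]
      · linarith [abs_nonneg (Real.log (2 * C'))]
    have hlog2 : Real.log (d₂ / 2) = Real.log d₂ - Real.log 2 := by
      rw [Real.log_div hd₂.ne' two_ne_zero]
    have hlogCc : Real.log (2 * Cc) = Real.log 2 + Real.log Cc := Real.log_mul two_ne_zero hCc0.ne'
    have hle_max : Real.log (2 * Cc) ≤ max (Real.log A) (Real.log (2 * Cc)) := le_max_right _ _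
    linarith
  · -- Case A: the `(1:γ)`-test
    push Not at hcase
    obtain ⟨R, hR, hineq0⟩ := exists_test_pdist hη hT₁ hT₂ hD hDT hk hu Y U
    have hineq : Real.exp Y * d₁ ^ T ≤ A * ‖eval u R‖ := by
      rw [hA, hΛ, hd₁def]; exact hineq0
    obtain ⟨hRpos, hlog⟩ := log_le_of_exp_mul_le (pow_pos hd₁ T) hA0 (norm_nonneg _) hineq
    refine ⟨R, hR, hRpos, ?_⟩
    rw [Real.log_pow] at hlog
    have hle_max : Real.log A ≤ max (Real.log A) (Real.log (2 * Cc)) := le_max_left _ _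
    have habs : 0 ≤ |Real.log (2 * C')| := abs_nonneg _
    split_ifs with hd₂
    · -- `log d₂ < log(2C') + T log d₁`
      have h3 : Real.log d₂ < Real.log (2 * C') + T * Real.log d₁ := by
        have := Real.log_lt_log hd₂ hcase
        rwa [Real.log_mul (by positivity) (by positivity), Real.log_pow] at this
      have hmax : max (T * Real.log d₁) (Real.log d₂) ≤ T * Real.log d₁ + |Real.log (2 * C')| := by
        refine max_le (by linarith) ?_
        linarith [le_abs_self (Real.log (2 * C'))]
      linarith
    · rw [max_self]
      linarith

/-- **Points outside `𝒰`**: see the module docstring. [cite: Roy2013, §7, Step 2 (points of `Z ∖ 𝒰`), Proposition 4.2] -/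
theorem exists_test_far {ξ η : ℂ} (hη : η ≠ 0) {L T D k : ℕ} (hT₁ : (L + 1).choose 2 < T)
    (hT₂ : T ≤ (L + 2).choose 2) (hD : 3 * (L + 1) ≤ D) (hDT : D ≤ T)
    (hk : 2 ^ k * T ≤ 3 ^ k * D) {u : Fin 3 → ℂ} (hu : ∀ i, ‖u i‖ ≤ 1)
    (hdU : (2 * roy_c2 ξ η)⁻¹ < pdist ξ η u) (Y U : ℝ) :
    ∃ R ∈ royBody D ξ η Y U T, 0 < ‖eval u R‖ ∧
      Y + T * Real.log ((2 * roy_c2 ξ η)⁻¹) ≤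
        Real.log (2 ^ T * (3 * (3 * (1 + ‖ξ‖ + ‖η‖⁻¹) * max 1 (max ‖ξ‖ ‖η‖)) ^ T *
              (16 * (T : ℝ) ^ 3) ^ T) ^ k) + Real.log ‖eval u R‖ := by
  have hc2 : 1 ≤ roy_c2 ξ η := one_le_roy_c2 ξ η
  have hρ : 0 < (2 * roy_c2 ξ η)⁻¹ := by positivity
  have hd₁ : 0 < pdist ξ η u := hρ.trans hdU
  have hTpos : (0 : ℝ) < T := by exact_mod_cast lt_of_le_of_lt (Nat.zero_le _) hT₁
  have hbase : (0 : ℝ) < 3 * (1 + ‖ξ‖ + ‖η‖⁻¹) * max 1 (max ‖ξ‖ ‖η‖) := by positivity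
  have h16 : (0 : ℝ) < 16 * (T : ℝ) ^ 3 := mul_pos (by norm_num) (pow_pos hTpos 3)
  have hA0 : (0 : ℝ) < 2 ^ T * (3 * (3 * (1 + ‖ξ‖ + ‖η‖⁻¹) * max 1 (max ‖ξ‖ ‖η‖)) ^ T *
      (16 * (T : ℝ) ^ 3) ^ T) ^ k :=
    mul_pos (pow_pos two_pos _) (pow_pos (mul_pos (mul_pos three_pos (pow_pos hbase _))
      (pow_pos h16 _)) _)
  obtain ⟨R, hR, hineq⟩ := exists_test_pdist hη hT₁ hT₂ hD hDT hk hu Y U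
  obtain ⟨hRpos, hlog⟩ := log_le_of_exp_mul_le (pow_pos hd₁ T) hA0 (norm_nonneg _) hineq
  refine ⟨R, hR, hRpos, ?_⟩
  rw [Real.log_pow] at hlog
  have hmono : Real.log ((2 * roy_c2 ξ η)⁻¹) ≤ Real.log (pdist ξ η u) := Real.log_le_log hρ hdU.le
  have hT0 : (0 : ℝ) ≤ T := Nat.cast_nonneg T
  nlinarith [mul_le_mul_of_nonneg_left hmono hT0]

end Roy2013

end Literature.NumberTheory.Transcendental
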